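import Literature.NumberTheory.Transcendental.ExpPointsLogTypeRegular
import Literature.NumberTheory.Transcendental.ExpPointsGeometryBasic
import Literature.Analysis.Complex.AnalyticLocalUniformizer
import Literature.Analysis.Complex.RayGrowthContradiction
import HarnessLib

/-!
# Log-type ends of a curve of exponential points, pole case: no accumulation of hits

Setting as in `ExpPointsLogTypeRegular.lean`: a branch at infinity
`𝔟(t) = ((t⁻ᵉ, Φ₁ t / tᴺ), (Φ₂ t / tᴺ, Φ₃ t / tᴺ)) ∈ W` through independent exponential points
accumulating at `t = 0`, multiplicative coordinates `yⱼ = t^{μⱼ} e^{ℓⱼ}`, `(μ₀, μ₁) ≠ 0`. If the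
meromorphic germ `Φ = μ₁ (x₀ - ℓ₀) - μ₀ (x₁ - ℓ₁)` (which lies in `2πiℤ` at every hit) has a
genuine POLE at `0`, we derive a contradiction (`false_of_logType_pole`): in the uniformizing
coordinate `s = σ(t)` with `Φ = s^{-f}` (`AnalyticLocalUniformizer`) the hits lie on the finitely
many rays `s^{2f} ∈ ℝ_{<0} · …` (`s/|s|` a `2f`-th root of `-1`); a pigeonhole
(`ExpPointsGeometryBasic.exists_infinite_class`) gives one ray with hits accumulating at `0`, and
along it `Re xⱼ` (a meromorphic germ in `s`) would have to equal `μⱼ log |t| + Re ℓⱼ(t)`,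
which is impossible (`RayGrowthContradiction`). PROVED, no definition. [folklore]
-/

noncomputable section

open Complex Filter Topology Set Metric Polynomial

namespace Literature.NumberTheory.Transcendental

open Literature.Analysis.Complex.MeromorphicGerm (analyticAt_pow_succ_mul_div_pow
  analyticAt_pow_succ_mul_inv_pow frequently_nhdsNE_of_forall_exists)
open Literature.Analysis.Complex.LaurentGerm (analyticAt_pow_add analyticAt_add analyticAt_const_mul)
open Literature.Analysis.Complex.LocalUniformizer (exists_uniformizer)
open Literature.Analysis.Complex.RayGrowth (false_of_re_eq_log_along_ray)

/-- The branch point `((t⁻ᵉ, Φ₁ t / tᴺ), (Φ₂ t / tᴺ, Φ₃ t / tᴺ)) ∈ ℂ² × ℂ²` (local notation). -/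
local notation3 "𝔟[" e ", " N ", " Φ₁ ", " Φ₂ ", " Φ₃ ", " t "]" =>
  (Sum.elim ![((t : ℂ) ^ (e : ℕ))⁻¹, (Φ₁ : ℂ → ℂ) t / t ^ (N : ℕ)]
    ![(Φ₂ : ℂ → ℂ) t / t ^ (N : ℕ), (Φ₃ : ℂ → ℂ) t / t ^ (N : ℕ)] : Fin 2 ⊕ Fin 2 → ℂ)

/-! ### Rays -/

/-- **Directions of the hits.** If `(s^f)⁻¹ = 2πik` with `k ∈ ℤ ∖ 0` then the direction `s/|s|`
is a `2f`-th root of `-1`. [folklore] -/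
theorem dir_pow_eq_neg_one {s : ℂ} {f : ℕ} (hf : 0 < f) {k : ℤ} (hk : k ≠ 0)
    (h : (s ^ f)⁻¹ = k * (2 * Real.pi * I)) : (s / (‖s‖ : ℂ)) ^ (2 * f) = -1 := by
  set d : ℂ := (k : ℂ) * (2 * Real.pi * I) with hd
  have hd0 : d ≠ 0 := by simp [hd, hk, Real.pi_ne_zero, I_ne_zero]
  have hsf : s ^ f = d⁻¹ := by rw [← h, inv_inv]
  have hs0 : s ≠ 0 := by
    rintro rfl; rw [zero_pow hf.ne'] at hsf; exact inv_ne_zero hd0 hsf.symm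
  have hnd : ((‖s‖ : ℂ)) ^ f = (‖d‖ : ℂ)⁻¹ := by
    rw [← Complex.ofReal_pow, ← norm_pow, hsf, norm_inv, Complex.ofReal_inv]
  have hnormd : (‖d‖ : ℂ) ^ 2 = -d ^ 2 := by
    have h1 : ‖d‖ = |(k : ℝ)| * (2 * Real.pi) := by
      rw [hd, norm_mul, Complex.norm_intCast]
      congr 1
      rw [norm_mul, Complex.norm_I, mul_one, Complex.norm_mul, Complex.norm_real, Complex.norm_two,
        Real.norm_eq_abs, abs_of_pos Real.pi_pos]
    rw [h1, hd]
    push_cast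
    have h2 : ((|(k : ℝ)| : ℝ) : ℂ) ^ 2 = (k : ℂ) ^ 2 := by
      rw [← Complex.ofReal_pow, sq_abs]; push_cast; ring
    calc (((|(k : ℝ)| : ℝ) : ℂ) * (2 * (Real.pi : ℂ))) ^ 2
        = (((|(k : ℝ)| : ℝ) : ℂ)) ^ 2 * (2 * Real.pi) ^ 2 := by ring
      _ = (k : ℂ) ^ 2 * (2 * Real.pi) ^ 2 := by rw [h2]
      _ = -((k : ℂ) * (2 * Real.pi * I)) ^ 2 := by
          have hI : I ^ 2 = -1 := I_sq
          linear_combination ((k : ℂ) ^ 2 * (2 * Real.pi) ^ 2) * hI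
  have hdn0 : (‖d‖ : ℂ) ≠ 0 := by exact_mod_cast norm_ne_zero_iff.2 hd0
  calc (s / (‖s‖ : ℂ)) ^ (2 * f) = (s ^ f / (‖s‖ : ℂ) ^ f) ^ 2 := by rw [mul_comm, pow_mul, div_pow]
    _ = (d⁻¹ / (‖d‖ : ℂ)⁻¹) ^ 2 := by rw [hsf, hnd]
    _ = (‖d‖ : ℂ) ^ 2 / d ^ 2 := by rw [inv_div_inv, div_pow]
    _ = -1 := by rw [hnormd, neg_div, div_self (pow_ne_zero 2 hd0)]

/-- **Modulus at a hit**: `e^{z} = t^μ e^{ℓ}` gives `Re z = μ log |t| + Re ℓ`. [folklore] -/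
theorem re_eq_log_of_exp_eq {z t ℓt : ℂ} {μ : ℤ} (ht : t ≠ 0) (h : exp z = t ^ μ * exp ℓt) :
    z.re = μ * Real.log ‖t‖ + ℓt.re := by
  have h1 : Real.exp z.re = ‖t‖ ^ μ * Real.exp ℓt.re := by
    rw [← Complex.norm_exp, h, norm_mul, norm_zpow, Complex.norm_exp]
  have h2 := congrArg Real.log h1
  rwa [Real.log_exp, Real.log_mul (zpow_ne_zero _ (norm_ne_zero_iff.2 ht)) (Real.exp_ne_zero _),
    Real.log_zpow, Real.log_exp] at h2

/-! ### The pole case -/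

/-- **Log-type ends with a pole carry no accumulating hits.** In the setting of the module
docstring, if `(μ₀, μ₁) ≠ 0` and the germ `μ₁ (t⁻ᵉ - ℓ₀) - μ₀ (x₁ - ℓ₁)` is NOT regular at `0`
(does not coincide with an analytic germ on any punctured neighbourhood), the hits cannot
accumulate at `t = 0`: contradiction. [folklore] -/
theorem false_of_logType_pole {W : Set (Fin 2 ⊕ Fin 2 → ℂ)} {e : ℕ} {N : ℕ}
    {Φ₁ Φ₂ Φ₃ : ℂ → ℂ} (hΦ₁ : AnalyticAt ℂ Φ₁ 0)
    (hhit : ∀ δ : ℝ, 0 < δ → Set.Infinite {x | x ∈ indepExpPoints W ∧ ∃ t : ℂ, 0 < ‖t‖ ∧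
      ‖t‖ < δ ∧ Sum.elim x (Complex.exp ∘ x) = 𝔟[e, N, Φ₁, Φ₂, Φ₃, t]})
    {μ₀ μ₁ : ℤ} {ℓ₀ ℓ₁ : ℂ → ℂ} (hℓ₀ : AnalyticAt ℂ ℓ₀ 0) (hℓ₁ : AnalyticAt ℂ ℓ₁ 0)
    (hy₀ : ∀ᶠ t in 𝓝[≠] (0 : ℂ), Φ₂ t / t ^ N = t ^ μ₀ * exp (ℓ₀ t))
    (hy₁ : ∀ᶠ t in 𝓝[≠] (0 : ℂ), Φ₃ t / t ^ N = t ^ μ₁ * exp (ℓ₁ t))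
    (hμ : μ₀ ≠ 0 ∨ μ₁ ≠ 0)
    (hpole : ¬ ∃ Φh : ℂ → ℂ, AnalyticAt ℂ Φh 0 ∧ ∀ᶠ t in 𝓝[≠] (0 : ℂ),
      (μ₁ : ℂ) * ((t ^ e)⁻¹ - ℓ₀ t) - (μ₀ : ℂ) * (Φ₁ t / t ^ N - ℓ₁ t) = Φh t) : False := by
  classical
  -- ### Step A: the meromorphic germ `Φf` and `Ψ = t^K Φf`
  set Φf : ℂ → ℂ := fun t => (μ₁ : ℂ) * ((t ^ e)⁻¹ - ℓ₀ t) - (μ₀ : ℂ) * (Φ₁ t / t ^ N - ℓ₁ t)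
    with hΦf
  set K : ℕ := (e + 1) + (N + 1) with hK
  have hf₀ : AnalyticAt ℂ (fun t : ℂ => t ^ (e + 1) * (t ^ e)⁻¹) 0 := analyticAt_pow_succ_mul_inv_pow e
  have hf₁ : AnalyticAt ℂ (fun t : ℂ => t ^ (N + 1) * (Φ₁ t / t ^ N)) 0 :=
    analyticAt_pow_succ_mul_div_pow hΦ₁ N
  have hΨ : AnalyticAt ℂ (fun t : ℂ => t ^ K * Φf t) 0 := by
    have hfun : (fun t : ℂ => t ^ K * Φf t) = fun t =>
        (μ₁ : ℂ) * t ^ (N + 1) * (t ^ (e + 1) * (t ^ e)⁻¹) - (μ₁ : ℂ) * t ^ K * ℓ₀ t -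
          (μ₀ : ℂ) * t ^ (e + 1) * (t ^ (N + 1) * (Φ₁ t / t ^ N)) + (μ₀ : ℂ) * t ^ K * ℓ₁ t := by
      funext t; simp only [hΦf, hK]; ring
    rw [hfun]
    have hp : ∀ n : ℕ, AnalyticAt ℂ (fun t : ℂ => t ^ n) 0 := fun n => analyticAt_id.pow n
    exact ((((analyticAt_const.mul (hp _)).mul hf₀).sub ((analyticAt_const.mul (hp _)).mul hℓ₀)).sub
      ((analyticAt_const.mul (hp _)).mul hf₁)).add ((analyticAt_const.mul (hp _)).mul hℓ₁)
  -- ### Step B: `Ψ` is not identically zero and vanishes to order `m < K`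
  have hΨne : ¬ ∀ᶠ t in 𝓝 (0 : ℂ), t ^ K * Φf t = 0 := by
    intro h0
    apply hpole
    refine ⟨fun _ => 0, analyticAt_const, ?_⟩
    filter_upwards [eventually_nhdsWithin_of_eventually_nhds h0, self_mem_nhdsWithin] with t ht ht0
    have htne : t ≠ 0 := by rintro rfl; exact ht0 (Set.mem_singleton 0)
    exact (mul_eq_zero.1 ht).resolve_left (pow_ne_zero K htne)
  obtain ⟨m, V, hV, hV0, hΨV⟩ := (hΨ.exists_eventuallyEq_pow_smul_nonzero_iff).2 hΨne
  simp only [sub_zero, smul_eq_mul] at hΨV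
  have hmK : m < K := by
    by_contra hle
    push Not at hle
    apply hpole
    refine ⟨fun t => t ^ (m - K) * V t, (analyticAt_id.pow _).mul hV, ?_⟩
    filter_upwards [eventually_nhdsWithin_of_eventually_nhds hΨV, self_mem_nhdsWithin] with t ht ht0
    have htne : t ≠ 0 := by rintro rfl; exact ht0 (Set.mem_singleton 0)
    have hsplit : t ^ m = t ^ K * t ^ (m - K) := by rw [← pow_add, Nat.add_sub_cancel' hle]
    rw [hsplit, mul_assoc] at ht
    exact mul_left_cancel₀ (pow_ne_zero K htne) ht
  set f : ℕ := K - m with hfdef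
  have hfpos : 0 < f := Nat.sub_pos_of_lt hmK
  have hKmf : K = m + f := by rw [hfdef]; omega
  have hΦfV : ∀ᶠ t in 𝓝[≠] (0 : ℂ), Φf t = V t / t ^ f := by
    filter_upwards [eventually_nhdsWithin_of_eventually_nhds hΨV, self_mem_nhdsWithin] with t ht ht0
    have htne : t ≠ 0 := by rintro rfl; exact ht0 (Set.mem_singleton 0)
    rw [hKmf, pow_add, mul_assoc] at ht
    have ht' := mul_left_cancel₀ (pow_ne_zero m htne) ht
    rw [eq_div_iff (pow_ne_zero f htne), mul_comm, ht']
  -- ### Step C: the uniformizer `s = σ(t)`, `Φf = s^{-f}`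
  obtain ⟨σ, τ, w, u, hσ, hτ, hw, hu, hw0, hu0, hσw, hτu, hστ, hτσ, hunif⟩ :=
    exists_uniformizer hV hV0 hfpos
  have hΦσ : ∀ᶠ t in 𝓝[≠] (0 : ℂ), σ t ≠ 0 ∧ Φf t = ((σ t) ^ f)⁻¹ := by
    have hwne : ∀ᶠ t in 𝓝 (0 : ℂ), w t ≠ 0 := hw.continuousAt.eventually_ne hw0
    filter_upwards [hΦfV, eventually_nhdsWithin_of_eventually_nhds (hunif.and hwne),
      self_mem_nhdsWithin] with t hΦt ⟨hun, hwt⟩ ht0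
    have htne : t ≠ 0 := by rintro rfl; exact ht0 (Set.mem_singleton 0)
    have hσne : σ t ≠ 0 := by rw [hσw]; exact mul_ne_zero htne hwt
    have hVne : V t ≠ 0 := fun h0 => by rw [h0, mul_zero] at hun; exact pow_ne_zero f htne hun.symm
    refine ⟨hσne, ?_⟩
    rw [hΦt, eq_comm, inv_eq_iff_eq_inv, inv_div, eq_div_iff hVne]
    exact hun
  -- ### Step D: radius where everything holds; integrality at the hits
  obtain ⟨δA, hδA, hA⟩ := exists_radius_of_eventually ((hy₀.and hy₁).and hΦσ)
  obtain ⟨δL, hδL, hL⟩ := exists_radius_of_eventually_nhds hτσ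
  have hint : ∀ (x : Fin 2 → ℂ) (t : ℂ), 0 < ‖t‖ → ‖t‖ < δA →
      Sum.elim x (Complex.exp ∘ x) = 𝔟[e, N, Φ₁, Φ₂, Φ₃, t] →
      ∃ k : ℤ, k ≠ 0 ∧ ((σ t) ^ f)⁻¹ = k * (2 * Real.pi * I) := by
    intro x t ht0 htδ hpt
    obtain ⟨⟨h0, h1⟩, hσne, hΦt⟩ := hA t ht0 htδ
    have hx0 : x 0 = (t ^ e)⁻¹ := by
      have := congrFun hpt (Sum.inl 0); simpa using this
    have hx1 : x 1 = Φ₁ t / t ^ N := by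
      have := congrFun hpt (Sum.inl 1); simpa using this
    have hex0 : exp (x 0) = Φ₂ t / t ^ N := by
      have := congrFun hpt (Sum.inr 0); simpa using this
    have hex1 : exp (x 1) = Φ₃ t / t ^ N := by
      have := congrFun hpt (Sum.inr 1); simpa using this
    have htne : t ≠ 0 := norm_pos_iff.1 ht0
    have hE0 : exp (x 0 - ℓ₀ t) = t ^ μ₀ := by
      rw [Complex.exp_sub, hex0, h0, mul_div_assoc, div_self (Complex.exp_ne_zero _), mul_one]
    have hE1 : exp (x 1 - ℓ₁ t) = t ^ μ₁ := by
      rw [Complex.exp_sub, hex1, h1, mul_div_assoc, div_self (Complex.exp_ne_zero _), mul_one]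
    have hone : exp (Φf t) = 1 := by
      have : Φf t = (μ₁ : ℂ) * (x 0 - ℓ₀ t) - (μ₀ : ℂ) * (x 1 - ℓ₁ t) := by
        simp only [hΦf, hx0, hx1]
      rw [this, Complex.exp_sub, Complex.exp_int_mul, Complex.exp_int_mul, hE0, hE1, ← zpow_mul,
        ← zpow_mul, mul_comm μ₀ μ₁, div_self (zpow_ne_zero _ htne)]
    obtain ⟨k, hk⟩ := Complex.exp_eq_one_iff.1 hone
    rw [hΦt] at hk
    refine ⟨k, ?_, hk⟩
    rintro rfl
    simp only [Int.cast_zero, zero_mul, inv_eq_zero] at hk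
    exact pow_ne_zero f hσne hk
  -- ### Step E: the pairs `(x, t)` and the pigeonhole on directions
  set T : Set ((Fin 2 → ℂ) × ℂ) := {p | p.1 ∈ indepExpPoints W ∧ 0 < ‖p.2‖ ∧ ‖p.2‖ < δA ∧
    Sum.elim p.1 (Complex.exp ∘ p.1) = 𝔟[e, N, Φ₁, Φ₂, Φ₃, p.2]} with hTdef
  have hT : ∀ R : ℝ, Set.Infinite {p | p ∈ T ∧ R < ‖p.2‖⁻¹} := by
    intro R hfin
    have hRpos : 0 < max R 1 := lt_of_lt_of_le one_pos (le_max_right _ _)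
    apply hhit (min δA (max R 1)⁻¹) (lt_min hδA (inv_pos.2 hRpos))
    refine (hfin.image Prod.fst).subset ?_
    rintro x ⟨hxH, t, ht0, htδ, hpt⟩
    refine ⟨(x, t), ⟨⟨hxH, ht0, htδ.trans_le (min_le_left _ _), hpt⟩, ?_⟩, rfl⟩
    have h1 : ‖t‖ < (max R 1)⁻¹ := htδ.trans_le (min_le_right _ _)
    calc R ≤ max R 1 := le_max_left _ _
      _ < ‖t‖⁻¹ := by rwa [lt_inv_comm₀ hRpos ht0]
  set L : Finset ℂ := Polynomial.nthRootsFinset (2 * f) (-1 : ℂ) with hLdef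
  set U : ℂ → Set ((Fin 2 → ℂ) × ℂ) := fun ζ => {p | σ p.2 = ζ * (‖σ p.2‖ : ℂ)} with hU
  have hcov : ∀ p ∈ T, ∃ ζ ∈ L, p ∈ U ζ := by
    rintro ⟨x, t⟩ ⟨hxH, ht0, htδ, hpt⟩
    obtain ⟨k, hk, hkt⟩ := hint x t ht0 htδ hpt
    obtain ⟨-, hσne, -⟩ := hA t ht0 htδ
    refine ⟨σ t / (‖σ t‖ : ℂ), ?_, ?_⟩
    · rw [hLdef, Polynomial.mem_nthRootsFinset (by omega)]
      exact dir_pow_eq_neg_one hfpos hk hkt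
    · show σ t = σ t / (‖σ t‖ : ℂ) * (‖σ t‖ : ℂ)
      rw [div_mul_cancel₀ _ (by exact_mod_cast norm_ne_zero_iff.2 hσne)]
  obtain ⟨ζ, hζL, hcls⟩ := exists_infinite_class hT L U hcov
  have hζ1 : ‖ζ‖ = 1 := by
    obtain ⟨p, ⟨⟨-, hp0, hpδ, -⟩, hpU, -⟩⟩ := (hcls 0).nonempty
    obtain ⟨-, hσne, -⟩ := hA p.2 hp0 hpδ
    have h := congrArg (fun z : ℂ => ‖z‖) hpU
    simp only [norm_mul, Complex.norm_real, Real.norm_eq_abs, abs_norm] at h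
    have hn : ‖σ p.2‖ ≠ 0 := norm_ne_zero_iff.2 hσne
    field_simp at h
    linarith [h]
  -- ### Step F: the contradiction along the ray `s = ζ ρ`
  -- hits of the class with arbitrarily small `σ t`
  have hsmall : ∀ δ : ℝ, 0 < δ → ∃ (x : Fin 2 → ℂ) (t : ℂ), (x, t) ∈ T ∧ σ t = ζ * (‖σ t‖ : ℂ) ∧
      0 < ‖σ t‖ ∧ ‖σ t‖ < δ ∧ ‖t‖ < δL := by
    intro δ hδ
    obtain ⟨δσ, hδσ, hσδ⟩ : ∃ δσ > 0, ∀ t : ℂ, ‖t‖ < δσ → ‖σ t‖ < δ := by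
      have h0 : σ 0 = 0 := by rw [hσw]; simp
      have := Metric.continuousAt_iff.1 hσ.continuousAt δ hδ
      obtain ⟨δσ, hδσ, h⟩ := this
      refine ⟨δσ, hδσ, fun t ht => ?_⟩
      have := h (by simpa [dist_eq_norm] using ht)
      simpa [dist_eq_norm, h0] using this
    have hRpos : 0 < (min δσ δL)⁻¹ := inv_pos.2 (lt_min hδσ hδL)
    obtain ⟨p, ⟨hpT, hpU, hpR⟩⟩ := (hcls (min δσ δL)⁻¹).nonempty
    obtain ⟨hxH, hp0, hpδ, hpt⟩ := hpT
    have hsmallt : ‖p.2‖ < min δσ δL := by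
      rwa [lt_inv_comm₀ hRpos hp0, inv_inv] at hpR
    obtain ⟨-, hσne, -⟩ := hA p.2 hp0 hpδ
    exact ⟨p.1, p.2, ⟨hxH, hp0, hpδ, hpt⟩, hpU, norm_pos_iff.2 hσne,
      hσδ p.2 (hsmallt.trans_le (min_le_left _ _)), hsmallt.trans_le (min_le_right _ _)⟩
  -- the common ray argument for a coordinate `xⱼ = Θ(s)/s^M` with `e^{xⱼ} = t^{μ} e^{ℓ(t)}`
  have key : ∀ (μ : ℤ) (ℓ Θ : ℂ → ℂ) (M : ℕ), μ ≠ 0 → AnalyticAt ℂ ℓ 0 → AnalyticAt ℂ Θ 0 →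
      (∀ (x : Fin 2 → ℂ) (t : ℂ), (x, t) ∈ T → ‖t‖ < δL → ∃ z : ℂ,
        z = Θ (σ t) / (σ t) ^ M ∧ exp z = t ^ μ * exp (ℓ t)) → False := by
    intro μ ℓ Θ M hμ0 hℓan hΘan hcoord
    refine false_of_re_eq_log_along_ray hΘan hu hu0 hℓan M hζ1 (μ := (μ : ℝ))
      (by exact_mod_cast hμ0) fun δ hδ => ?_
    obtain ⟨x, t, hxt, hdir, hρ0, hρδ, htL⟩ := hsmall δ hδ
    obtain ⟨z, hz, hexp⟩ := hcoord x t hxt htL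
    have ht : t = ζ * (‖σ t‖ : ℂ) * u (ζ * (‖σ t‖ : ℂ)) := by rw [← hdir, ← hτu, hL t htL]
    have htne : t ≠ 0 := norm_pos_iff.1 hxt.2.1
    refine ⟨‖σ t‖, hρ0, hρδ, ?_⟩
    rw [← ht, ← hdir, ← hz]
    exact re_eq_log_of_exp_eq htne hexp
  -- ### Step G: apply to the coordinate with `μⱼ ≠ 0`
  rcases hμ with hμ₀ | hμ₁
  · -- `j = 0`: `x₀ = t⁻ᵉ = ((u s)ᵉ)⁻¹ / sᵉ`
    refine key μ₀ ℓ₀ (fun s => ((u s) ^ e)⁻¹) e hμ₀ hℓ₀ ((hu.pow e).inv (pow_ne_zero e hu0)) ?_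
    rintro x t ⟨hxH, ht0, htδ, hpt⟩ htL
    obtain ⟨⟨h0, -⟩, hσne, -⟩ := hA t ht0 htδ
    have hx0 : x 0 = (t ^ e)⁻¹ := by
      have := congrFun hpt (Sum.inl 0); simpa using this
    have hex0 : exp (x 0) = Φ₂ t / t ^ N := by
      have := congrFun hpt (Sum.inr 0); simpa using this
    refine ⟨x 0, ?_, by rw [hex0, h0]⟩
    have ht : t = σ t * u (σ t) := by rw [← hτu, hL t htL]
    rw [hx0]
    conv_lhs => rw [ht]
    rw [mul_pow, mul_inv, div_eq_mul_inv, mul_comm]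
  · -- `j = 1`: `x₁ = Φ₁(t)/tᴺ = (Φ₁ (s u s) ((u s)ᴺ)⁻¹) / sᴺ`
    have hΘ : AnalyticAt ℂ (fun s => Φ₁ (s * u s) * ((u s) ^ N)⁻¹) 0 := by
      have h1 : AnalyticAt ℂ (fun s : ℂ => s * u s) 0 := analyticAt_id.mul hu
      have h2 : AnalyticAt ℂ Φ₁ ((fun s : ℂ => s * u s) 0) := by
        rw [show (fun s : ℂ => s * u s) 0 = 0 by simp]; exact hΦ₁
      exact (AnalyticAt.comp (g := Φ₁) (f := fun s : ℂ => s * u s) (x := 0) h2 h1).mul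
        ((hu.pow N).inv (pow_ne_zero N hu0))
    refine key μ₁ ℓ₁ (fun s => Φ₁ (s * u s) * ((u s) ^ N)⁻¹) N hμ₁ hℓ₁ hΘ ?_
    rintro x t ⟨hxH, ht0, htδ, hpt⟩ htL
    obtain ⟨⟨-, h1⟩, hσne, -⟩ := hA t ht0 htδ
    have hx1 : x 1 = Φ₁ t / t ^ N := by
      have := congrFun hpt (Sum.inl 1); simpa using this
    have hex1 : exp (x 1) = Φ₃ t / t ^ N := by
      have := congrFun hpt (Sum.inr 1); simpa using this
    refine ⟨x 1, ?_, by rw [hex1, h1]⟩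
    have ht : t = σ t * u (σ t) := by rw [← hτu, hL t htL]
    rw [hx1]
    conv_lhs => rw [ht]
    have hune : u (σ t) ≠ 0 := by
      intro h0; rw [h0, mul_zero] at ht; exact (norm_pos_iff.1 ht0) ht
    rw [mul_pow]
    field_simp

end Literature.NumberTheory.Transcendental

end
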